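import Mathlib
import Literature.Analysis.FluidPDE.Tao2016AveragedNS.SelfSimilarCascadeBlowup
import Literature.Analysis.FluidPDE.Tao2016AveragedNS.WeightedLatticeFlows
import Literature.Analysis.FluidPDE.Tao2016AveragedNS.ViscousSmoothingBootstrap
import HarnessLib

/-!
# A Beale–Kato–Majda-type continuation criterion for the exact cascade lattice, part 1/2 (the
  LINEARISATION ESTIMATE): at the blow-up time of the maximal exact flow the SCALE-CRITICAL amplitude `sup_k Λ^k |X_{i,k}(t)|` (`Λ^k = (1+ε₀)^{5k/2}`,
  the quantity of the type-I clause of the K2 extraction) is UNBOUNDED — support for the extraction stub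
  `stub_eternalFromBlowup` of K2(1) `TaoLadderRungTwoBreak.BlowupRigidityOne` (stmt-NavierStokesRegularity-20206)

MODEL lattice ODEs only (Tao 2016 §4, the exact cascade (4.12) of a table with bounded structure
constants); nothing here is a statement about the Navier–Stokes equations; NO item is closed
(`--supports stmt-NavierStokesRegularity-20206`). Route-independent module.

THE POINT. `BlowupRigidityOne.maximalExactFlow_of_noGlobalCascade` gives, from robust blow-up, the
maximal exact flow on `[0,T⋆)` with the (4.5)-weighted norm `sup_{i,k}(1+(1+ε₀)^{10k})|X_{i,k}(t)|`
unbounded as `t ↑ T⋆`. The weight `(1+ε₀)^{10k}` is Tao's bookkeeping choice; the extraction stub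
renormalises with the CRITICAL weight `Λ^k = (1+ε₀)^{5k/2}` (`W_n(σ) = Λ^n e^{-σ} X_n(T⋆ - e^{-σ})`;
type I = `Λ^k (T⋆-t)|X_k(t)| ≤ C`). This file proves the lattice analogue of the Beale–Kato–Majda
principle «no blow-up while the Lipschitz norm stays bounded»:

* `weight45_mul_abs_quadTerm_le` — the one-sided LINEARISATION estimate: if `Λ^k|X_{j,k}| ≤ L` on all
  shells (the «Lipschitz norm») and `(1+(1+ε₀)^{10k})|X_{j,k}| ≤ N` on all shells, then
  `(1+(1+ε₀)^{10n})|quadTerm_{i,n}(X)| ≤ m² M_α L (3 + (1+ε₀)^{10}) N` — every quadratic monomial of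
  (4.8) carries exactly one factor `Λ^{shell}`, which is spent on ONE of its two amplitudes;
* (sibling module `…CriticalBlowup`) `weight45_bound_of_critical_bound` — GRONWALL: an exact flow on `[0,T)` (derivatives within `[0,∞)`),
  (4.5)-regular on every `[0,T']`, `T' < T`, whose critical amplitudes stay bounded
  (`Λ^k|X_{i,k}(t)| ≤ L` on `[0,T)`) keeps its (4.5) norm bounded UNIFORMLY up to `T`
  (`≤ N(0)·e^{KT}`, `K = m² M_α L (3+(1+ε₀)^{10})`; Grönwall in the Dini form
  `le_gronwallBound_of_liminf_deriv_right_le` for the supremum `N(t)` over the countably many modes,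
  which is Lipschitz on compact sub-intervals by the a priori bound);
* (sibling module `…CriticalBlowup`) `critical_unbounded_of_maximalExactFlow` /
  `criticalBlowup_of_noGlobalCascade` — hence along the
  maximal exact flow of a robustly blowing-up `E₂(R)` table the critical amplitude
  `sup_{i,k} Λ^k|X_{i,k}(t)|` is unbounded on `[0,T⋆)`: the blow-up delivered by `NoGlobalCascade` is a
  blow-up IN THE TYPE-I QUANTITY, whatever admissible weight detected it. (Type I itself —
  `Λ^k(T⋆-t)|X_k(t)| ≤ C` — is the open step N-39 and is NOT claimed.)
-/

noncomputable section

-- the summit and its single sub-problem share the name (CONVENTIONS §1)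
set_option linter.dupNamespace false

open Set Filter Topology Finset

namespace Summit.NavierStokesRegularity.NavierStokesRegularity.Theorems

namespace BlowupRigidityOne

open Literature.Analysis.FluidPDE Literature.Analysis.FluidPDE.TaoCascade

variable {m : ℕ}

/-! ### The linearisation estimate -/

/-- A bilinear block bound: `|Σ_{i₁,i₂} c (u i₁ · v i₂)| ≤ m² M_c B_u B_v` (copy of the private lemma of
`Tao2016AveragedNS.ViscousSmoothingBootstrap`). [folklore] -/
private theorem abs_sum_sum_mul_le {c : Fin m → Fin m → ℝ} {u v : Fin m → ℝ} {Mc Bu Bv : ℝ}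
    (hMc : 0 ≤ Mc) (hBu : 0 ≤ Bu) (hc : ∀ i j, |c i j| ≤ Mc) (hu : ∀ i, |u i| ≤ Bu)
    (hv : ∀ j, |v j| ≤ Bv) :
    |∑ i, ∑ j, c i j * (u i * v j)| ≤ (m : ℝ) ^ 2 * Mc * (Bu * Bv) := by
  have hterm : ∀ i j, |c i j * (u i * v j)| ≤ Mc * (Bu * Bv) := fun i j => by
    rw [abs_mul, abs_mul]
    exact mul_le_mul (hc i j) (mul_le_mul (hu i) (hv j) (abs_nonneg _) hBu)
      (mul_nonneg (abs_nonneg _) (abs_nonneg _)) hMc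
  calc |∑ i, ∑ j, c i j * (u i * v j)| ≤ ∑ i, |∑ j, c i j * (u i * v j)| := abs_sum_le_sum_abs _ _
    _ ≤ ∑ i, ∑ j, |c i j * (u i * v j)| := sum_le_sum fun i _ => abs_sum_le_sum_abs _ _
    _ ≤ ∑ _i : Fin m, ∑ _j : Fin m, Mc * (Bu * Bv) :=
        sum_le_sum fun i _ => sum_le_sum fun j _ => hterm i j
    _ = (m : ℝ) ^ 2 * Mc * (Bu * Bv) := by
        rw [sum_const, sum_const, card_univ, Fintype.card_fin, nsmul_eq_mul, nsmul_eq_mul]; ring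

/-- **The linearisation estimate.** Structure constants bounded by `M_α`, `ε₀ ≥ 0`. If at time `s`
every mode obeys the CRITICAL bound `(1+ε₀)^{5k/2}|X_{j,k}(s)| ≤ L` and the (4.5)-weighted bound
`(1+(1+ε₀)^{10k})|X_{j,k}(s)| ≤ N`, then
`(1+(1+ε₀)^{10n})|quadTerm_{i,n}(X)(s)| ≤ m² M_α L (3+(1+ε₀)^{10}) N` for every mode `(i,n)`: in each of
the four blocks of (4.8) (`quadTerm_four_shifts`) the gain `(1+ε₀)^{5·shell/2}` is absorbed by the
critical bound of one factor, the weight by the other (`(1+(1+ε₀)^{10n}) ≤ (1+ε₀)^{10}(1+(1+ε₀)^{10(n-1)})`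
for the block fed from shell `n-1`). [cite: Tao2016AveragedNS, §4 (4.8) (the main term on the shift set `S`)] -/
theorem weight45_mul_abs_quadTerm_le {ε₀ Mα L Nv : ℝ} (hε : 0 ≤ ε₀) (hMα : 0 ≤ Mα) (hL : 0 ≤ L)
    (hNv : 0 ≤ Nv) {α : Fin m → Fin m → Fin m → ℤ × ℤ × ℤ → ℝ}
    (hα : ∀ i₁ i₂ i₃ μ, |α i₁ i₂ i₃ μ| ≤ Mα) {X : Fin m → ℤ → ℝ → ℝ} {s : ℝ}
    (hLip : ∀ (j : Fin m) (k : ℤ), (1 + ε₀) ^ ((5 : ℝ) * k / 2) * |X j k s| ≤ L)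
    (hN : ∀ (j : Fin m) (k : ℤ), (1 + (1 + ε₀) ^ ((10 : ℝ) * k)) * |X j k s| ≤ Nv)
    (i : Fin m) (n : ℤ) :
    (1 + (1 + ε₀) ^ ((10 : ℝ) * n)) * |quadTerm ε₀ α X i n s| ≤
      (m : ℝ) ^ 2 * Mα * L * (3 + (1 + ε₀) ^ (10 : ℝ)) * Nv := by
  have hl1 : (1 : ℝ) ≤ 1 + ε₀ := by linarith
  have hl0 : (0 : ℝ) < 1 + ε₀ := by linarith
  set P : ℤ → ℝ := fun k => (1 + ε₀) ^ ((5 : ℝ) * k / 2) with hPdef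
  set W : ℤ → ℝ := fun k => 1 + (1 + ε₀) ^ ((10 : ℝ) * k) with hWdef
  have hP : ∀ k, 0 < P k := fun k => Real.rpow_pos_of_pos hl0 _
  have hW : ∀ k, 0 < W k := fun k => by
    have := Real.rpow_nonneg hl0.le ((10 : ℝ) * k); simp only [hWdef]; linarith
  -- per-shell bounds
  have hu : ∀ j k, |X j k s| ≤ L / P k := fun j k => by
    rw [le_div_iff₀ (hP k), mul_comm]; exact hLip j k
  have hv : ∀ j k, |X j k s| ≤ Nv / W k := fun j k => by
    rw [le_div_iff₀ (hW k), mul_comm]; exact hN j k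
  have hu0 : ∀ k, 0 ≤ L / P k := fun k => div_nonneg hL (hP k).le
  have hv0 : ∀ k, 0 ≤ Nv / W k := fun k => div_nonneg hNv (hW k).le
  -- the four blocks
  have h1 := abs_sum_sum_mul_le hMα (hu0 n) (fun i₁ i₂ => hα i₁ i₂ i (0, 0, 0))
    (fun j => hu j n) (fun j => hv j n)
  have h2 := abs_sum_sum_mul_le hMα (hu0 (n + 1)) (fun i₁ i₂ => hα i₁ i₂ i (1, 0, 0))
    (fun j => hu j (n + 1)) (fun j => hv j n)
  have h3 := abs_sum_sum_mul_le hMα (hv0 n) (fun i₁ i₂ => hα i₁ i₂ i (0, 1, 0))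
    (fun j => hv j n) (fun j => hu j (n + 1))
  have h4 := abs_sum_sum_mul_le hMα (hu0 (n - 1)) (fun i₁ i₂ => hα i₁ i₂ i (0, 0, 1))
    (fun j => hu j (n - 1)) (fun j => hv j (n - 1))
  -- the gains against the critical factors
  have hPn : (1 + ε₀) ^ ((5 : ℝ) * n / 2) = P n := rfl
  have hPn1 : (1 + ε₀) ^ ((5 : ℝ) * ((n : ℝ) - 1) / 2) = P (n - 1) := by
    simp only [hPdef, Int.cast_sub, Int.cast_one]
  have hPmono : P n ≤ P (n + 1) := by
    simp only [hPdef]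
    refine Real.rpow_le_rpow_of_exponent_le hl1 ?_
    push_cast; linarith
  have e1 : P n * (L / P n * (Nv / W n)) = L * (Nv / W n) := by
    rw [div_mul_eq_mul_div, mul_div_assoc', mul_div_cancel_left₀ _ (hP n).ne']
  have e2 : P n * (L / P (n + 1) * (Nv / W n)) ≤ L * (Nv / W n) := by
    have : P n * (L / P (n + 1)) ≤ L := by
      rw [mul_div_assoc', div_le_iff₀ (hP (n + 1)), mul_comm]
      exact mul_le_mul_of_nonneg_left hPmono hL
    calc P n * (L / P (n + 1) * (Nv / W n)) = (P n * (L / P (n + 1))) * (Nv / W n) := by ring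
      _ ≤ L * (Nv / W n) := mul_le_mul_of_nonneg_right this (hv0 n)
  have e3 : P n * ((Nv / W n) * (L / P (n + 1))) ≤ L * (Nv / W n) := by
    rw [mul_comm (Nv / W n) (L / P (n + 1))]; exact e2
  have e4 : P (n - 1) * (L / P (n - 1) * (Nv / W (n - 1))) = L * (Nv / W (n - 1)) := by
    rw [div_mul_eq_mul_div, mul_div_assoc', mul_div_cancel_left₀ _ (hP (n - 1)).ne']
  -- the weight ratio `W n ≤ (1+ε₀)^10 · W (n-1)`
  have hWW : W n ≤ (1 + ε₀) ^ (10 : ℝ) * W (n - 1) := by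
    have h10 : (1 : ℝ) ≤ (1 + ε₀) ^ (10 : ℝ) := Real.one_le_rpow hl1 (by norm_num)
    have hE : 0 ≤ (1 + ε₀) ^ ((10 : ℝ) * (((n - 1 : ℤ)) : ℝ)) := Real.rpow_nonneg hl0.le _
    have hsplit : (1 + ε₀) ^ ((10 : ℝ) * n) =
        (1 + ε₀) ^ (10 : ℝ) * (1 + ε₀) ^ ((10 : ℝ) * (((n - 1 : ℤ)) : ℝ)) := by
      rw [← Real.rpow_add hl0]; congr 1; push_cast; ring
    simp only [hWdef]
    rw [hsplit]
    nlinarith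
  -- assemble
  have hPn0 : 0 ≤ P n := (hP n).le
  have hPm0 : 0 ≤ P (n - 1) := (hP (n - 1)).le
  have hm2 : 0 ≤ (m : ℝ) ^ 2 * Mα := by positivity
  have hqT : |(1 + ε₀) ^ ((5 : ℝ) * n / 2) *
          (∑ i₁, ∑ i₂, (α i₁ i₂ i (0, 0, 0) * (X i₁ n s * X i₂ n s) +
            α i₁ i₂ i (1, 0, 0) * (X i₁ (n + 1) s * X i₂ n s) +
            α i₁ i₂ i (0, 1, 0) * (X i₁ n s * X i₂ (n + 1) s))) +
        (1 + ε₀) ^ ((5 : ℝ) * ((n : ℝ) - 1) / 2) *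
          ∑ i₁, ∑ i₂, α i₁ i₂ i (0, 0, 1) * (X i₁ (n - 1) s * X i₂ (n - 1) s)| ≤
      (m : ℝ) ^ 2 * Mα * L * (3 * (Nv / W n) + Nv / W (n - 1)) := by
    rw [hPn, hPn1]
    calc |P n * (∑ i₁, ∑ i₂, (α i₁ i₂ i (0, 0, 0) * (X i₁ n s * X i₂ n s) +
            α i₁ i₂ i (1, 0, 0) * (X i₁ (n + 1) s * X i₂ n s) +
            α i₁ i₂ i (0, 1, 0) * (X i₁ n s * X i₂ (n + 1) s))) +
          P (n - 1) * ∑ i₁, ∑ i₂, α i₁ i₂ i (0, 0, 1) * (X i₁ (n - 1) s * X i₂ (n - 1) s)|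
        ≤ P n * (|∑ i₁, ∑ i₂, α i₁ i₂ i (0, 0, 0) * (X i₁ n s * X i₂ n s)| +
            |∑ i₁, ∑ i₂, α i₁ i₂ i (1, 0, 0) * (X i₁ (n + 1) s * X i₂ n s)| +
            |∑ i₁, ∑ i₂, α i₁ i₂ i (0, 1, 0) * (X i₁ n s * X i₂ (n + 1) s)|) +
          P (n - 1) * |∑ i₁, ∑ i₂, α i₁ i₂ i (0, 0, 1) * (X i₁ (n - 1) s * X i₂ (n - 1) s)| := by
          refine (abs_add_le _ _).trans ?_
          rw [abs_mul, abs_mul, abs_of_nonneg hPn0, abs_of_nonneg hPm0]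
          refine add_le_add (mul_le_mul_of_nonneg_left ?_ hPn0) le_rfl
          simp only [sum_add_distrib]
          exact (abs_add_le _ _).trans (add_le_add (abs_add_le _ _) le_rfl)
      _ ≤ P n * ((m : ℝ) ^ 2 * Mα * (L / P n * (Nv / W n)) +
            (m : ℝ) ^ 2 * Mα * (L / P (n + 1) * (Nv / W n)) +
            (m : ℝ) ^ 2 * Mα * ((Nv / W n) * (L / P (n + 1)))) +
          P (n - 1) * ((m : ℝ) ^ 2 * Mα * (L / P (n - 1) * (Nv / W (n - 1)))) :=
          add_le_add (mul_le_mul_of_nonneg_left (add_le_add (add_le_add h1 h2) h3) hPn0)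
            (mul_le_mul_of_nonneg_left h4 hPm0)
      _ = (m : ℝ) ^ 2 * Mα * (P n * (L / P n * (Nv / W n)) + P n * (L / P (n + 1) * (Nv / W n)) +
            P n * ((Nv / W n) * (L / P (n + 1))) + P (n - 1) * (L / P (n - 1) * (Nv / W (n - 1)))) := by
          ring
      _ ≤ (m : ℝ) ^ 2 * Mα * (L * (Nv / W n) + L * (Nv / W n) + L * (Nv / W n) + L * (Nv / W (n - 1))) := by
          refine mul_le_mul_of_nonneg_left ?_ hm2
          rw [e1, e4]
          linarith [e2, e3]
      _ = (m : ℝ) ^ 2 * Mα * L * (3 * (Nv / W n) + Nv / W (n - 1)) := by ring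
  -- multiply by the weight
  have hWn : (1 + (1 + ε₀) ^ ((10 : ℝ) * n)) = W n := rfl
  rw [hWn]
  have hratio : W n * (Nv / W (n - 1)) ≤ (1 + ε₀) ^ (10 : ℝ) * Nv := by
    rw [mul_div_assoc', div_le_iff₀ (hW (n - 1))]
    calc W n * Nv ≤ ((1 + ε₀) ^ (10 : ℝ) * W (n - 1)) * Nv := mul_le_mul_of_nonneg_right hWW hNv
      _ = (1 + ε₀) ^ (10 : ℝ) * Nv * W (n - 1) := by ring
  have hself : W n * (Nv / W n) = Nv := by
    rw [mul_div_assoc', mul_div_cancel_left₀ _ (hW n).ne']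
  have hK0 : 0 ≤ (m : ℝ) ^ 2 * Mα * L := by positivity
  calc W n * |quadTerm ε₀ α X i n s|
      = W n * |(1 + ε₀) ^ ((5 : ℝ) * n / 2) *
          (∑ i₁, ∑ i₂, (α i₁ i₂ i (0, 0, 0) * (X i₁ n s * X i₂ n s) +
            α i₁ i₂ i (1, 0, 0) * (X i₁ (n + 1) s * X i₂ n s) +
            α i₁ i₂ i (0, 1, 0) * (X i₁ n s * X i₂ (n + 1) s))) +
        (1 + ε₀) ^ ((5 : ℝ) * ((n : ℝ) - 1) / 2) *
          ∑ i₁, ∑ i₂, α i₁ i₂ i (0, 0, 1) * (X i₁ (n - 1) s * X i₂ (n - 1) s)| := by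
        rw [← quadTerm_four_shifts]
    _ ≤ W n * ((m : ℝ) ^ 2 * Mα * L * (3 * (Nv / W n) + Nv / W (n - 1))) :=
        mul_le_mul_of_nonneg_left hqT (hW n).le
    _ = (m : ℝ) ^ 2 * Mα * L * (3 * (W n * (Nv / W n)) + W n * (Nv / W (n - 1))) := by ring
    _ ≤ (m : ℝ) ^ 2 * Mα * L * (3 * Nv + (1 + ε₀) ^ (10 : ℝ) * Nv) := by
        rw [hself]
        exact mul_le_mul_of_nonneg_left (by linarith [hratio]) hK0
    _ = (m : ℝ) ^ 2 * Mα * L * (3 + (1 + ε₀) ^ (10 : ℝ)) * Nv := by ring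

end BlowupRigidityOne

end Summit.NavierStokesRegularity.NavierStokesRegularity.Theorems

end
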